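import Mathlib
import Summits.PneNP.PneNP.Theorems.ConvexRankGatesConvexGateBlindExactLiftingTriangleLineCover

/-!
# PneNP / ConvexRankGates — `ConvexGateBlind`, line `xor-door-perfect-completeness`:
# the MASS INEQUALITY for shifted factorisations of the triangle instance (prover seat 0, session 21)

Helper toward crux item stmt-PneNP-10680 (`--supports`; open stub `stub_exactLifting`, instance of record = the
triangle matrix `M_t[x,w] = #monochromatic edges of the transversal triangle w under the 2-colouring x`, in the
vocabulary `Col`, `Tri`, `monoCount`, `IsMono` of `…ExactLiftingTriangleLineCover`).

Fix `0 < ε ≤ 1` and a non-negative factorisation `M_t[x,w] − ε = Σ_{l<R} u_l(x) v_l(w)`.  For a column factor `v`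
write `|v| = Σ_w v(w)` (mass), `v(Mono_x) = Σ_{w mono under x} v(w)`, and let `w⋆_l` be a point where `v_l` peaks.
The theorem `triangle_mass_bound` of this file:

  `ε · t³ · 8^t ≤ 12 · Σ_l (|v_l| / v_l(w⋆_l)) · #{x : (1/2 + ε/12)|v_l| ≤ v_l(Mono_x)}`.

Reading: the row `x` of `M_t − εJ` has L¹-mass `(1−ε)t³ + 2#Mono_x`, of which `(3−ε)#Mono_x` sits on the
monochromatic quarter — a SHARE `1/2 + Θ(ε)` for typical rows, while a junta line `1_{(a,b,·)}` has share exactly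
`1/2` on the rows where it is monochromatic.  Splitting the generators of a row into those whose own share is below
`1/2 + ε/12` and the SERVERS (share `≥ 1/2 + ε/12`), the servers must carry a `Θ(ε)` fraction of the row's mass; and a
generator carries at most `(3 − ε)·|v_l|/max v_l` mass in any row, because one non-negative term is below the entry
`M − ε ≤ 3 − ε` at the peak.  Summing over all `8^t` rows (`Σ_x #Mono_x = t³8^t/4`, `four_mul_sum_card_mono`) gives the
display.  Companion files bound `(|v|/max v)·#{x : share ≥ 1/2 + c}` by `polylog(t)·c^{-10}·8^t` for EVERY non-negative `v`
(Hoeffding peeling over the three blocks), whence `R ≥ ε^{11} t³ / (K ln⁴ t)`: exponent `3` at every fixed shift.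
Elementary finite sums; no definitions (`monoSet x` is file-local NOTATION for the filter of monochromatic triangles).
-/

set_option linter.dupNamespace false -- `Summit.PneNP.PneNP.…`: summit = sub-problem (D-0017)

namespace Summit.PneNP.PneNP.Theorems.XorDoor.TriLine

open scoped BigOperators
open Finset

noncomputable section

variable {t : ℕ}

/-- The monochromatic transversal triangles of the colouring `x` (notation only, no definition). -/
local notation3 "monoSet " x:max => Finset.filter (fun w : Tri _ => IsMono x w.1 w.2.1 w.2.2) Finset.univ

/-- membership in `monoSet` -/
lemma mem_monoSet {x : Col t} {w : Tri t} : w ∈ monoSet x ↔ IsMono x w.1 w.2.1 w.2.2 := by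
  simp

/-- `M_t[x,w]` is `3` on monochromatic triangles and `1` elsewhere. -/
lemma monoCount_eq_ite (x : Col t) (w : Tri t) :
    (monoCount x w : ℝ) = if IsMono x w.1 w.2.1 w.2.2 then 3 else 1 := by
  rcases w with ⟨a, b, d⟩
  by_cases h : IsMono x a b d
  · rw [if_pos h, monoCount_of_isMono h]; norm_num
  · rw [if_neg h, monoCount_of_not_isMono h]; norm_num

/-- `M_t[x,w] ≤ 3`. -/
lemma monoCount_le_three (x : Col t) (w : Tri t) : (monoCount x w : ℝ) ≤ 3 := by
  rw [monoCount_eq_ite]; split_ifs <;> norm_num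

/-- Row sums: `Σ_w M_t[x,w] = t³ + 2·#Mono_x`. -/
lemma sum_monoCount (x : Col t) :
    ∑ w, (monoCount x w : ℝ) = (t : ℝ) ^ 3 + 2 * #(monoSet x) := by
  have h : ∀ w : Tri t, (monoCount x w : ℝ) =
      1 + 2 * (if IsMono x w.1 w.2.1 w.2.2 then (1 : ℝ) else 0) := by
    intro w; rw [monoCount_eq_ite]; split_ifs <;> norm_num
  simp_rw [h]
  rw [sum_add_distrib, sum_const, card_univ, ← mul_sum, nsmul_eq_mul, mul_one]
  congr 1
  · simp [Fintype.card_prod, Fintype.card_fin]; ring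
  · rw [Finset.card_filter, Nat.cast_sum]
    congr 1
    refine sum_congr rfl fun w _ => ?_
    split_ifs <;> simp

/-- Monochromatic row sums: `Σ_{w mono} M_t[x,w] = 3·#Mono_x`. -/
lemma sum_monoSet_monoCount (x : Col t) :
    ∑ w ∈ monoSet x, (monoCount x w : ℝ) = 3 * #(monoSet x) := by
  rw [sum_congr rfl fun w hw => monoCount_eq_ite x w]
  rw [sum_congr rfl fun w hw => if_pos (mem_monoSet.1 hw), sum_const, nsmul_eq_mul, mul_comm]

/-- `Σ_x #Mono_x = t³ 8^t / 4` as a real identity. -/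
lemma sum_card_monoSet_real :
    4 * ∑ x : Col t, (#(monoSet x) : ℝ) = (t : ℝ) ^ 3 * 8 ^ t := by
  have h := four_mul_sum_card_mono (t := t)
  have h' : ((4 * ∑ x : Col t, #(univ.filter fun w : Tri t => IsMono x w.1 w.2.1 w.2.2) : ℕ) : ℝ)
      = ((t ^ 3 * (2 ^ t * 2 ^ t * 2 ^ t) : ℕ) : ℝ) := by rw [h]
  push_cast at h'
  have h8 : (2 : ℝ) ^ t * 2 ^ t * 2 ^ t = 8 ^ t := by
    rw [← mul_pow, ← mul_pow]; norm_num
  rw [h8] at h'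
  simpa using h'

section Factorisation

variable {R : ℕ} {ε : ℝ} {u : Col t → Fin R → ℝ} {v : Fin R → Tri t → ℝ} {wmax : Fin R → Tri t}

/-- One non-negative term is below the entry: `u_l(x) · v_l(w⋆_l) ≤ 3 − ε`. -/
lemma coeff_mul_peak_le (hu : ∀ x l, 0 ≤ u x l) (hv : ∀ l w, 0 ≤ v l w)
    (hfact : ∀ x w, (monoCount x w : ℝ) - ε = ∑ l, u x l * v l w) (x : Col t) (l : Fin R) :
    u x l * v l (wmax l) ≤ 3 - ε := by
  have h1 : u x l * v l (wmax l) ≤ ∑ l', u x l' * v l' (wmax l) :=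
    single_le_sum (f := fun l' => u x l' * v l' (wmax l)) (fun l' _ => mul_nonneg (hu x l') (hv l' _))
      (mem_univ l)
  rw [← hfact] at h1
  linarith [monoCount_le_three x (wmax l)]

/-- Mass costs breadth: `u_l(x)·|v_l| ≤ (3 − ε)·|v_l|/v_l(w⋆_l)` when `w⋆_l` is a peak of `v_l`. -/
lemma coeff_mul_mass_le (hu : ∀ x l, 0 ≤ u x l) (hv : ∀ l w, 0 ≤ v l w)
    (hwmax : ∀ l w, v l w ≤ v l (wmax l))
    (hfact : ∀ x w, (monoCount x w : ℝ) - ε = ∑ l, u x l * v l w) (x : Col t) (l : Fin R) :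
    u x l * ∑ w, v l w ≤ (3 - ε) * ((∑ w, v l w) / v l (wmax l)) := by
  by_cases h0 : v l (wmax l) = 0
  · have hz : ∀ w, v l w = 0 := fun w => le_antisymm (h0 ▸ hwmax l w) (hv l w)
    simp [hz]
  · have hpos : 0 < v l (wmax l) := lt_of_le_of_ne (hv l _) (Ne.symm h0)
    have hms : 0 ≤ ∑ w, v l w := sum_nonneg fun w _ => hv l w
    have hkey := coeff_mul_peak_le (wmax := wmax) hu hv hfact x l
    calc u x l * ∑ w, v l w = (u x l * v l (wmax l)) * ((∑ w, v l w) / v l (wmax l)) := by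
          field_simp
      _ ≤ (3 - ε) * ((∑ w, v l w) / v l (wmax l)) :=
          mul_le_mul_of_nonneg_right hkey (div_nonneg hms hpos.le)

/-- The row identity summed over all columns: `t³ + 2#Mono_x − ε t³ = Σ_l u_l(x)|v_l|`. -/
lemma row_mass (hfact : ∀ x w, (monoCount x w : ℝ) - ε = ∑ l, u x l * v l w) (x : Col t) :
    (t : ℝ) ^ 3 + 2 * #(monoSet x) - ε * t ^ 3 = ∑ l, u x l * ∑ w, v l w := by
  have h : ∑ w, ((monoCount x w : ℝ) - ε) = ∑ w, ∑ l, u x l * v l w := sum_congr rfl fun w _ => hfact x w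
  rw [sum_sub_distrib, sum_monoCount, sum_const, card_univ, nsmul_eq_mul, sum_comm] at h
  simp only [Fintype.card_prod, Fintype.card_fin, Nat.cast_mul] at h
  have h' : (t : ℝ) ^ 3 + 2 * #(monoSet x) - ε * t ^ 3 = ∑ l, ∑ w, u x l * v l w := by
    rw [← h]; ring
  rw [h']
  exact sum_congr rfl fun l _ => by rw [mul_sum]

/-- The row identity summed over the monochromatic columns: `(3 − ε)#Mono_x = Σ_l u_l(x) v_l(Mono_x)`. -/
lemma row_monoMass (hfact : ∀ x w, (monoCount x w : ℝ) - ε = ∑ l, u x l * v l w) (x : Col t) :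
    (3 - ε) * #(monoSet x) = ∑ l, u x l * ∑ w ∈ monoSet x, v l w := by
  have h : ∑ w ∈ monoSet x, ((monoCount x w : ℝ) - ε) = ∑ w ∈ monoSet x, ∑ l, u x l * v l w :=
    sum_congr rfl fun w _ => hfact x w
  rw [sum_sub_distrib, sum_monoSet_monoCount, sum_const, nsmul_eq_mul, sum_comm] at h
  rw [show (3 - ε) * (#(monoSet x) : ℝ) = 3 * #(monoSet x) - #(monoSet x) * ε by ring, h]
  exact sum_congr rfl fun l _ => by rw [mul_sum]

/-- **The mass inequality of one row.**  With `c = ε/12`, `br_l = |v_l|/v_l(w⋆_l)` and the server test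
`Sv(x,l) : (1/2 + c)|v_l| ≤ v_l(Mono_x)`:
`(3−ε)#Mono_x − (1/2+c)(t³ + 2#Mono_x − εt³) ≤ (1/2−c)(3−ε) Σ_l [Sv(x,l)]·br_l`. -/
lemma row_mass_inequality (hε1 : ε ≤ 1) (hu : ∀ x l, 0 ≤ u x l) (hv : ∀ l w, 0 ≤ v l w)
    (hwmax : ∀ l w, v l w ≤ v l (wmax l))
    (hfact : ∀ x w, (monoCount x w : ℝ) - ε = ∑ l, u x l * v l w) (x : Col t) :
    (3 - ε) * #(monoSet x) - (1 / 2 + ε / 12) * ((t : ℝ) ^ 3 + 2 * #(monoSet x) - ε * t ^ 3)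
      ≤ (1 / 2 - ε / 12) * (3 - ε) *
        ∑ l, (if (1 / 2 + ε / 12) * ∑ w, v l w ≤ ∑ w ∈ monoSet x, v l w
              then (∑ w, v l w) / v l (wmax l) else 0) := by
  rw [row_monoMass hfact x, row_mass hfact x, mul_sum, mul_sum, ← sum_sub_distrib]
  refine sum_le_sum fun l _ => ?_
  have hms : 0 ≤ ∑ w, v l w := sum_nonneg fun w _ => hv l w
  have hsub : ∑ w ∈ monoSet x, v l w ≤ ∑ w, v l w :=
    sum_le_sum_of_subset_of_nonneg (subset_univ _) fun w _ _ => hv l w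
  have hmass := coeff_mul_mass_le (wmax := wmax) hu hv hwmax hfact x l
  have hul : 0 ≤ u x l := hu x l
  have hc : 0 ≤ 1 / 2 - ε / 12 := by linarith
  split_ifs with hS
  · -- a server: its monochromatic mass is at most its mass, and its mass costs breadth
    have h1 : u x l * ∑ w ∈ monoSet x, v l w ≤ u x l * ∑ w, v l w := mul_le_mul_of_nonneg_left hsub hul
    nlinarith
  · -- not a server: its monochromatic mass is below `(1/2 + c)` of its mass
    have hS := not_le.1 hS
    have h1 : u x l * ∑ w ∈ monoSet x, v l w ≤ u x l * ((1 / 2 + ε / 12) * ∑ w, v l w) :=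
      mul_le_mul_of_nonneg_left hS.le hul
    nlinarith

/-- **THE MASS INEQUALITY** (all rows).  For `0 < ε ≤ 1` and every non-negative factorisation of `M_t − εJ`:
`ε·t³·8^t ≤ 12·Σ_l (|v_l|/v_l(w⋆_l))·#{x : (1/2 + ε/12)|v_l| ≤ v_l(Mono_x)}`, `w⋆_l` any peak of `v_l`. -/
theorem mass_bound (hε0 : 0 < ε) (hε1 : ε ≤ 1) (hu : ∀ x l, 0 ≤ u x l) (hv : ∀ l w, 0 ≤ v l w)
    (hwmax : ∀ l w, v l w ≤ v l (wmax l))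
    (hfact : ∀ x w, (monoCount x w : ℝ) - ε = ∑ l, u x l * v l w) :
    ε * (t : ℝ) ^ 3 * 8 ^ t ≤ 12 * ∑ l, (∑ w, v l w) / v l (wmax l) *
      #(univ.filter fun x : Col t => (1 / 2 + ε / 12) * ∑ w, v l w ≤ ∑ w ∈ monoSet x, v l w) := by
  -- sum the row inequalities
  have hrows := fun x => row_mass_inequality (wmax := wmax) hε1 hu hv hwmax hfact x
  have hsum := sum_le_sum fun x (_ : x ∈ (univ : Finset (Col t))) => hrows x
  -- the left-hand side in closed form
  have hS := sum_card_monoSet_real (t := t)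
  set S : ℝ := ∑ x : Col t, (#(monoSet x) : ℝ) with hSdef
  have hL : ∑ x : Col t, ((3 - ε) * #(monoSet x) - (1 / 2 + ε / 12) * ((t : ℝ) ^ 3 + 2 * #(monoSet x) - ε * t ^ 3))
      = (3 - ε) * S - (1 / 2 + ε / 12) * ((t : ℝ) ^ 3 * 8 ^ t + 2 * S - ε * (t ^ 3 * 8 ^ t)) := by
    rw [sum_sub_distrib, ← mul_sum, ← mul_sum, sum_sub_distrib, sum_add_distrib, ← mul_sum, ← mul_sum,
      sum_const, card_univ]
    simp only [Fintype.card_prod, Fintype.card_fun, Fintype.card_bool, Fintype.card_fin, nsmul_eq_mul,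
      Nat.cast_mul, Nat.cast_pow, Nat.cast_ofNat]
    have h8 : (2 : ℝ) ^ t * (2 ^ t * 2 ^ t) = 8 ^ t := by rw [← mul_pow, ← mul_pow]; norm_num
    rw [h8]; ring
  -- the right-hand side: exchange the sums and count
  have hRt : ∑ x : Col t, (1 / 2 - ε / 12) * (3 - ε) *
      ∑ l, (if (1 / 2 + ε / 12) * ∑ w, v l w ≤ ∑ w ∈ monoSet x, v l w then (∑ w, v l w) / v l (wmax l) else 0)
      = (1 / 2 - ε / 12) * (3 - ε) * ∑ l, (∑ w, v l w) / v l (wmax l) *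
        #(univ.filter fun x : Col t => (1 / 2 + ε / 12) * ∑ w, v l w ≤ ∑ w ∈ monoSet x, v l w) := by
    rw [← mul_sum, sum_comm]
    congr 1
    refine sum_congr rfl fun l _ => ?_
    rw [← sum_filter, sum_const, nsmul_eq_mul, mul_comm]
  rw [hL, hRt] at hsum
  -- arithmetic
  have hX : 0 ≤ ∑ l, (∑ w, v l w) / v l (wmax l) *
      #(univ.filter fun x : Col t => (1 / 2 + ε / 12) * ∑ w, v l w ≤ ∑ w ∈ monoSet x, v l w) := by
    refine sum_nonneg fun l _ => mul_nonneg ?_ (Nat.cast_nonneg _)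
    by_cases h0 : v l (wmax l) = 0
    · simp [h0]
    · exact div_nonneg (sum_nonneg fun w _ => hv l w) (hv l _)
  have hT : 0 ≤ (t : ℝ) ^ 3 * 8 ^ t := by positivity
  have hS4 : S = (t : ℝ) ^ 3 * 8 ^ t / 4 := by rw [hSdef]; linarith
  rw [hS4] at hsum
  set X : ℝ := ∑ l, (∑ w, v l w) / v l (wmax l) *
      #(univ.filter fun x : Col t => (1 / 2 + ε / 12) * ∑ w, v l w ≤ ∑ w ∈ monoSet x, v l w) with hXdef
  set T : ℝ := (t : ℝ) ^ 3 * 8 ^ t with hTdef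
  have h1 : (1 / 2 - ε / 12) * (3 - ε) * X ≤ 3 / 2 * X := by
    have : 0 ≤ ε * (3 / 4 - ε / 12) * X := mul_nonneg (mul_nonneg hε0.le (by linarith)) hX
    nlinarith
  have h2 : (3 - ε) * (T / 4) - (1 / 2 + ε / 12) * (T + 2 * (T / 4) - ε * T) = T * (ε / 8 + ε ^ 2 / 12) := by
    ring
  rw [h2] at hsum
  have h3 : 0 ≤ T * (ε ^ 2 / 12) := mul_nonneg hT (by positivity)
  nlinarith

end Factorisation

/-- **Mass inequality for shifted factorisations of the triangle instance** (explicit-vocabulary restatement of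
`mass_bound`, the form registered as sub-goal `triangle_mass_bound` of stmt-PneNP-10680): for `0 < ε ≤ 1`, every
non-negative factorisation `M_t − ε = Σ_{l<R} u_l ⊗ v_l` and every choice of peaks `w⋆_l` of the `v_l`,
`ε t³ 8^t ≤ 12 Σ_l (|v_l|/v_l(w⋆_l)) · #{x : (1/2 + ε/12)|v_l| ≤ v_l(Mono_x)}`. -/
theorem triangle_mass_bound :
    ∀ (t R : ℕ) (ε : ℝ), 0 < ε → ε ≤ 1 →
    ∀ (u : (Fin t → Bool) × (Fin t → Bool) × (Fin t → Bool) → Fin R → ℝ) (v : Fin R → Fin t × Fin t × Fin t → ℝ)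
      (wmax : Fin R → Fin t × Fin t × Fin t),
    (∀ x l, 0 ≤ u x l) → (∀ l w, 0 ≤ v l w) → (∀ l w, v l w ≤ v l (wmax l)) →
    (∀ x w, (((if x.1 w.1 = x.2.1 w.2.1 then 1 else 0) + (if x.1 w.1 = x.2.2 w.2.2 then 1 else 0) +
      (if x.2.1 w.2.1 = x.2.2 w.2.2 then 1 else 0) : ℕ) : ℝ) - ε = ∑ l, u x l * v l w) →
    ε * (t : ℝ) ^ 3 * 8 ^ t ≤ 12 * ∑ l, (∑ w, v l w) / v l (wmax l) *
      ((Finset.univ.filter fun x : (Fin t → Bool) × (Fin t → Bool) × (Fin t → Bool) =>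
        (1 / 2 + ε / 12) * ∑ w, v l w ≤
          ∑ w ∈ (Finset.univ.filter fun w : Fin t × Fin t × Fin t => x.1 w.1 = x.2.1 w.2.1 ∧ x.1 w.1 = x.2.2 w.2.2),
            v l w).card : ℝ) :=
  fun _t _R _ε hε0 hε1 _u _v _wmax hu hv hwmax hfact =>
    mass_bound hε0 hε1 hu hv hwmax (fun x w => by simpa [monoCount] using hfact x w)

end

end Summit.PneNP.PneNP.Theorems.XorDoor.TriLine
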